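import Literature.MathematicalPhysics.QuantumFieldTheory.ONArchipelagoObligations
import Literature.MathematicalPhysics.QuantumFieldTheory.ConformalBootstrap3D.MixedOddTail
import HarnessLib

/-!
# The vector-row tail of an `O(N)` archipelago point certificate through the `σ–ε` odd bridge

Seventh file of the archipelago rung.  The `V` rows of Kos–Poland–Simmons-Duffin–Vichi 2015 §2.2 of a
point 7-vector `ofPoints z z̄ w` ARE the `ℤ₂`-odd rows of the `σ–ε` point 5-vector with weights
`oddWeights w = (0, 0, w₄, w₅, w₆)` at `(Δ_σ, Δ_ε) = (Δ_φ, Δ_s)` (`vectorPositive_ofPoints_iff`,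
`ONArchipelagoObligations.lean`).  The `σ–ε` chain has a coefficient-free tail rule for the odd sector
(`ConformalBootstrap3D/MixedOddTail.lean`): the Cauchy–Schwarz budget of the signed `φsφs` row against
the reflection-positive `sφφs` row (Pappadopulo–Rychkov–Espin–Rattazzi 2012 §5) bounds the odd form
below by the DOMINATING EVALUATION `𝔇[g] = φ_{w₅}[F^{Δφ}_-[g]] − φ_{w₆}[F^{Δφ}_+[g]] − φ_{|w₄|}[F^{Δφ}_+[g]]`
of the positive-series block alone (`oddDomEval_oddWeights`), a two-weight evaluation with
`c = w₅ − w₆ − |w₄|`, `d = w₅ + w₆ + |w₄|`; so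

* (M_V) per box `E ∈ [E₁,E₂]`, `Δ_φ ∈ [φ_lo, φ_hi]`: ONE number `cornerBound₂(c, d) ≥ 0`
  (`vectorDom_nonneg_of_cornerBound₂`);
* (T_V) apex `a`: `w₅ₐ − w₆ₐ − |w₄ₐ| ≥ 0` and
  `R(w₅; φ_lo, E_T) + R(w₆; φ_lo, E_T) + R(|w₄|; φ_lo, E_T) ≤ (w₅ₐ − w₆ₐ − |w₄ₐ|) v_a^{φ_hi}`;
* together: `VectorPositive` at every `(Δ_φ, Δ_s) ∈ Q ⊆ [φ_lo,φ_hi] × [s_lo,s_hi]`, every spin of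
  either parity, every `Δ ≥ E₀ > 1` above the unitarity bound, regular or not
  (`tail_vectorPositive_of_boxes_and_apex`) — the `tail_V` item of `ArchipelagoObligations`.

The rule is SUFFICIENT, not an identity (it budgets the signed row at its worst case), exactly as in the
`σ–ε` file.  No table, no number, no `sorry`.

Sources: arXiv:1504.07997 §2.2 (`KosPolandSimmonsDuffinVichi2015`); F. Kos, D. Poland,
D. Simmons-Duffin, JHEP 11 (2014) 109, §3.3 eq. (3.16) (`KosPolandSimmonsduffin2014`); D. Pappadopulo,
S. Rychkov, J. Espin, R. Rattazzi, Phys. Rev. D 86 (2012) 105043, §5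
(`PappadopuloRychkovEspinRattazzi2012`).
-/

noncomputable section

namespace Literature.MathematicalPhysics.QuantumFieldTheory.ONArchipelagoSystem

open Finset Set Filter Topology
open ConformalBootstrap3D (IsConformalBlock3D unitarityBound3D crossF CrossingFunctional pointFunctional
  pointFunctional_apply zMono oddDomEval oddDomEval_nonneg_of_cornerBound₂ cornerBound₂ apexRest
  tail_oddPositive_of_boxes_and_apex)

namespace ArchipelagoFunctional

/-! ### The odd weights of a point 7-vector, componentwise -/

/-- `(oddWeights w)₂ = w₄` (the `α₅` slot). [cite: KosPolandSimmonsDuffinVichi2015, §2.2 (functional conditions)] -/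
theorem oddWeights_two {n : ℕ} (w : Fin 7 → Fin n → ℝ) : oddWeights w 2 = w 4 := by
  funext k; simp [oddWeights]

/-- `(oddWeights w)₃ = w₅` (the `α₆` slot). [cite: KosPolandSimmonsDuffinVichi2015, §2.2 (functional conditions)] -/
theorem oddWeights_three {n : ℕ} (w : Fin 7 → Fin n → ℝ) : oddWeights w 3 = w 5 := by
  funext k; simp [oddWeights]

/-- `(oddWeights w)₄ = w₆` (the `α₇` slot). [cite: KosPolandSimmonsDuffinVichi2015, §2.2 (functional conditions)] -/
theorem oddWeights_four {n : ℕ} (w : Fin 7 → Fin n → ℝ) : oddWeights w 4 = w 6 := by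
  funext k; simp [oddWeights]

/-! ### The dominating evaluation of the `V` rows -/

/-- **The dominating evaluation of the `V` rows of a point 7-vector**:
`𝔇[g] = φ_{w₅}[F^{t}_-[g]] − φ_{w₆}[F^{t}_+[g]] − φ_{|w₄|}[F^{t}_+[g]]` (the `σ–ε` `oddDomEval` at the odd
weights). [cite: PappadopuloRychkovEspinRattazzi2012, §5] -/
theorem oddDomEval_oddWeights {n : ℕ} (z zb : Fin n → ℝ) (w : Fin 7 → Fin n → ℝ) (t : ℝ)
    (g : ℝ → ℝ → ℝ) :
    oddDomEval z zb (oddWeights w) t g =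
      pointFunctional (w 5) z zb (crossF t (-1) g) - pointFunctional (w 6) z zb (crossF t 1 g) -
        pointFunctional (fun k => |w 4 k|) z zb (crossF t 1 g) := by
  simp only [oddDomEval, oddWeights_two, oddWeights_three, oddWeights_four]

/-- **(M_V) on a box from one number**: `cornerBound₂ (w₅−w₆−|w₄|) (w₅+w₆+|w₄|) j E₁ E₂ φ_lo φ_hi ≥ 0`
gives `𝔇[𝒫_{E,j}] ≥ 0` for every `E ∈ [E₁,E₂]`, `Δ_φ ∈ [φ_lo,φ_hi]`. Elementary.
[cite: HogervorstRychkov2013, §3 eq. (3.6)] -/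
theorem vectorDom_nonneg_of_cornerBound₂ {n : ℕ} (z zb : Fin n → ℝ) (w : Fin 7 → Fin n → ℝ)
    (hz : ∀ k, z k ∈ Ioo (0 : ℝ) 1) (hzb : ∀ k, zb k ∈ Ioo (0 : ℝ) 1) (j : ℕ)
    {E₁ E₂ φlo φhi : ℝ}
    (h : 0 ≤ cornerBound₂ (fun k => w 5 k - w 6 k - |w 4 k|) (fun k => w 5 k + w 6 k + |w 4 k|)
      z zb j E₁ E₂ φlo φhi)
    {E t : ℝ} (hE : E ∈ Icc E₁ E₂) (ht : t ∈ Icc φlo φhi) :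
    0 ≤ oddDomEval z zb (oddWeights w) t (zMono E j) :=
  oddDomEval_nonneg_of_cornerBound₂ z zb (oddWeights w) hz hzb j
    (by simpa only [oddWeights_two, oddWeights_three, oddWeights_four] using h) hE ht

/-! ### The `V` tail -/

/-- **The `V` tail on a box, all spins and points.** Nodes in the open square with `z̄_k ≤ z_k`, a
dominating apex `a`; `Q ⊆ [φ_lo,φ_hi] × [s_lo,s_hi]`; (M_V) on `E ∈ [E₀, E_T)`, `j + τ ≤ E`
(`τ ≤ 1`, `τ ≤ E₀`, `E₀ > 1`; box by box through `vectorDom_nonneg_of_cornerBound₂`); (T_V) the sign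
condition `w₅ₐ − w₆ₐ − |w₄ₐ| ≥ 0` and the one apex inequality. Then `VectorPositive` holds at every point
of `Q`, every spin (either parity) and every `Δ ≥ E₀` with `unitarityBound3D ℓ ≤ Δ` — the `tail_V`
item of `ArchipelagoObligations` for a point 7-vector. [cite: PappadopuloRychkovEspinRattazzi2012, §5] -/
theorem tail_vectorPositive_of_boxes_and_apex {n : ℕ} (z zb : Fin n → ℝ) (w : Fin 7 → Fin n → ℝ)
    (hz : ∀ k, z k ∈ Ioo (0 : ℝ) 1) (hzb : ∀ k, zb k ∈ Ioo (0 : ℝ) 1) (hord : ∀ k, zb k ≤ z k)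
    (a : Fin n) (qd qr : Fin n → ℝ) (hqd : ∀ k, 0 < qd k ∧ qd k ≤ 1)
    (hqr : ∀ k, 0 < qr k ∧ qr k ≤ 1)
    (hdomd : ∀ k, z k * zb k ≤ qd k ^ 2 * (z a * zb a) ∧ z k ≤ qd k * z a)
    (hdomr : ∀ k, (1 - z k) * (1 - zb k) ≤ qr k ^ 2 * (z a * zb a) ∧ 1 - zb k ≤ qr k * z a)
    {Q : Set (ℝ × ℝ)} {φlo φhi slo shi E₀ ET τ : ℝ}
    (hQ : ∀ p ∈ Q, (φlo ≤ p.1 ∧ p.1 ≤ φhi) ∧ (slo ≤ p.2 ∧ p.2 ≤ shi))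
    (hτ1 : τ ≤ 1) (hτ0 : τ ≤ E₀) (hE1 : 1 < E₀)
    (hM : ∀ (j : ℕ) (E : ℝ), E₀ ≤ E → E < ET → (j : ℝ) + τ ≤ E → ∀ p ∈ Q,
      0 ≤ oddDomEval z zb (oddWeights w) p.1 (zMono E j))
    (hc : 0 ≤ w 5 a - w 6 a - |w 4 a|)
    (hT : apexRest (w 5) z zb a qd qr φlo ET + apexRest (w 6) z zb a qd qr φlo ET +
        apexRest (fun k => |w 4 k|) z zb a qd qr φlo ET ≤
      (w 5 a - w 6 a - |w 4 a|) * ((1 - z a) * (1 - zb a)) ^ φhi) :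
    ∀ p ∈ Q, ∀ ℓ : ℕ, ∀ Δ : ℝ, unitarityBound3D ℓ ≤ Δ → E₀ ≤ Δ →
      (ofPoints z zb w).VectorPositive p.1 p.2 Δ ℓ :=
  fun p hp ℓ Δ hb h0 => (vectorPositive_ofPoints_iff z zb w p.1 p.2 Δ ℓ).2
    (tail_oddPositive_of_boxes_and_apex z zb (oddWeights w) hz hzb hord a qd qr hqd hqr hdomd hdomr hQ
      hτ1 hτ0 hE1 hM (by simpa only [oddWeights_two, oddWeights_three, oddWeights_four] using hc)
      (by simpa only [oddWeights_two, oddWeights_three, oddWeights_four] using hT) p hp ℓ Δ hb h0)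

end ArchipelagoFunctional

end Literature.MathematicalPhysics.QuantumFieldTheory.ONArchipelagoSystem
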